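import Literature.Topology.FourManifolds.HCobordismWallDuality
import Literature.AlgebraicTopology.SingularHomology.TriadLefschetzVanishing
import Literature.AlgebraicTopology.SingularHomology.RelFundamentalClassModTwo
import Literature.AlgebraicTopology.Homotopy.WhiteheadTheoremProofs
import Literature.AlgebraicTopology.Homotopy.CompactManifoldCWTypeProofs
import HarnessLib

/-!
# Wall's Theorem 2 along its printed proof, II bis: the duality step PROVED
# (`Cobordism.isZero_relativeSingularHomology_inl_of_inr_le_holds`)

Topic `Literature/Topology/FourManifolds`; sibling proof file of `HCobordismWallDuality.lean`, which
vendors the named fact `Cobordism.isZero_relativeSingularHomology_inl_of_inr_le` — the duality step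
"`Hₖ(R, M₁) ≅ H⁵⁻ᵏ(R, M₂) = 0`" of C. T. C. Wall, *On simply-connected 4-manifolds*, J. London
Math. Soc. 39 (1964), p. 146, as the homological corollary of A. Hatcher, *Algebraic Topology*
(2002), Thm. 3.43 (Poincaré–Lefschetz duality for a compact `R`-orientable manifold whose boundary
is decomposed into two pieces) with Thm. 3.2 (universal coefficients): **for a compact cobordism
`(W; M, N)` of dimension `n + 1` between compact Hausdorff `n`-manifolds carrying a relative
fundamental class `z ∈ Hₙ₊₁(W, ∂W; ℤ)`, if `Hⱼ(W, N; ℤ) = 0` for all `j ≤ m` then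
`Hₖ(W, M; ℤ) = 0` for all `k ≥ n + 1 − m`.**

This file DISCHARGES that fact (`Cobordism.isZero_relativeSingularHomology_inl_of_inr_le_holds`),
in every universe and every dimension, from theorems proved in the tree along Hatcher's printed
proof (p. 254: Lefschetz duality for `(W, ∂W)`, duality on `∂W`, the ladder of long exact
sequences, "the boundary map sends a fundamental class for `M` to a fundamental class for `∂M`"):

* `Literature.AlgebraicTopology.SingularHomology.isZero_relativeSingularHomology_of_boundary_split_typeZero`
  (`TriadLefschetzVanishing.lean`, manifolds in `Type`): the vanishing statement for a compact
  `ℤ`-oriented manifold with boundary split into two disjoint closed pieces `A ⊔ B` — Lefschetz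
  duality `a ↦ a ⌢ z` (Spanier Thm. 6.3.12, `bijective_relCapProduct_of_isRelFundamentalClass_holds`),
  Poincaré duality of `∂W` (Hatcher Thm. 3.30, `poincare_duality`) for the orientation whose
  fundamental class is `∂z` (Spanier Cor. 6.3.10, `BoundaryClassGenerator.lean` and
  `BoundaryClassGeneratorZero.lean`), the block form of that duality along `∂W = B ⊔ A` and the
  commuting square with the boundary map of the triple (`BoundaryPiecesDuality.lean`, Hatcher
  pp. 240–241, 254), universal coefficients for the pair `(W, B)` (Thm. 3.2,
  `RelativeCochainsVanishing.lean`) and the exact sequence of the triple `A ⊆ ∂W ⊆ W`;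
* `isZero_relativeSingularHomology_of_boundary_split` — the same in every universe: a compact
  manifold is small (`small_of_compactSpace_chartedSpace`), the copy `Shrink.{0} W` carries the
  transported atlas, boundaries and relative fundamental classes correspond
  (`mem_boundary_iff_of_homeomorph`, `IsRelFundamentalClass.xEquiv_of_homeomorph`,
  `RelFundamentalClassModTwo.lean`) and vanishing of relative homology is invariant
  (`relativeSingularHomology.isZero_of_homeomorph`);
* `Cobordism.isZero_relativeSingularHomology_inl_of_inr_le_holds` — for a cobordism the two
  pieces are `A = range inl ≅ M`, `B = range inr ≅ N` (compact, hence closed, disjoint, covering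
  `∂W` by the definition of `Cobordism`).

Everything is proved; no named fact is introduced; no statement of the tree is touched.

Appended (2026-08-15, after the D-0026 review that merged the layer-1 `R`-fact of
`HCobordismWall.lean` back into Thm. 2): **the last two sentences of Wall's proof, OUTRIGHT.** With
the duality step discharged here and Whitehead's theorem / the CW type of compact manifolds
discharged in `WhiteheadTheoremProofs.lean` / `CompactManifoldCWTypeProofs.lean`
(`whitehead_exists_homotopyEquiv_holds`, `exists_cwComplex_homotopyEquiv_of_compactSpace_holds`,
`exists_cwComplex_homotopyEquiv_of_compactSpace_boundary_holds`), the conditional theorems of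
`HCobordismWallDuality.lean` lose all their fact-hypotheses:

* `Cobordism.forall_isZero_relativeSingularHomology_of_le` — "and so also": a cobordism
  `W : Cobordism n M N` with simply connected total space whose relative groups of BOTH ends vanish
  in degrees `≤ m`, `n ≤ 2m`, has all relative groups of both ends zero;
* `Cobordism.isHCobordism_of_isZero_relativeSingularHomology_le'` — such a `W` between simply
  connected compact Hausdorff `n`-manifolds is an h-cobordism;
* `Cobordism.isHCobordism_of_isZero_relativeSingularHomology_le_two'` and
  `isHCobordant_of_isZero_relativeSingularHomology_le_two` — Wall's case `n = 4`, `m = 2`: **a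
  cobordism `R` between simply connected compact Hausdorff 4-manifolds with `R` simply connected and
  `Hₖ(R, M; ℤ) = Hₖ(R, N; ℤ) = 0` for `k ≤ 2` is an h-cobordism, so `M`, `N` are h-cobordant** —
  no hypothesis left. This is the call with which a construction of Wall's `R` (§2, pp. 144–146)
  together with his computation "`H₂(Mᵢ) → H₂(R)` are isomorphisms … Hence `Hₖ(R, Mᵢ) = 0` for
  `k ≤ 2`" closes `isHCobordant_of_equivalent_intersectionForm` (`HCobordismDonaldson.lean`) for the
  pair at hand.

## References

* A. Hatcher, *Algebraic Topology*, CUP 2002, §3.3 Thm. 3.43 (proof, p. 254), Thm. 3.30,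
  pp. 240–241; §3.1 Thm. 3.2, p. 200; §2.1 p. 118. [HatcherAT2002]
* E. H. Spanier, *Algebraic Topology*, Springer 1981, Ch. 6 §3 Cor. 10, Thm. 12. [Spanier1981]
* C. T. C. Wall, *On simply-connected 4-manifolds*, J. London Math. Soc. 39 (1964), §2, p. 146.
  [WallJLMS1964]
-/

noncomputable section

open scoped Manifold ContDiff
open CategoryTheory CategoryTheory.Limits Set
open Literature.AlgebraicTopology.SingularHomology

universe u

namespace Literature.Topology.FourManifolds

/-- **Hatcher's Thm. 3.43 with Thm. 3.2, vanishing form, in every universe.**  Let `W : Type u` be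
a compact Hausdorff topological manifold with boundary, charted on `EuclideanHalfSpace (n+1)`,
carrying a relative fundamental class `z ∈ Hₙ₊₁(W, ∂W; ℤ)`, with `∂W = A ⊔ B` for closed disjoint
`A`, `B`.  If `Hⱼ(W, B; ℤ) = 0` for all `j ≤ m` then `Hₖ(W, A; ℤ) = 0` for all `k` with
`n + 1 ≤ k + m`: transport to the small copy `Shrink.{0} W` and
`isZero_relativeSingularHomology_of_boundary_split_typeZero`.
[cite: HatcherAT2002, §3.3 Thm. 3.43 with Thm. 3.2] -/
theorem isZero_relativeSingularHomology_of_boundary_split {n m : ℕ} {W : Type u}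
    [TopologicalSpace W] [T2Space W] [CompactSpace W] [ChartedSpace (EuclideanHalfSpace (n + 1)) W]
    {A B : Set W} (hA : IsClosed A) (hB : IsClosed B) (hdisj : Disjoint A B)
    (hAB : A ∪ B = (𝓡∂ (n + 1)).boundary W)
    (z : relativeSingularHomology ℤ ℤ W ((𝓡∂ (n + 1)).boundary W) (n + 1))
    (hz : IsRelFundamentalClass ℤ ((𝓡∂ (n + 1)).boundary W) z)
    (hyp : ∀ j, j ≤ m → IsZero (relativeSingularHomology ℤ ℤ W B j)) (k : ℕ) (hk : n + 1 ≤ k + m) :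
    IsZero (relativeSingularHomology ℤ ℤ W A k) := by
  -- a copy of `W` in `Type`, with the transported atlas
  haveI : SecondCountableTopology (EuclideanHalfSpace (n + 1)) :=
    inferInstanceAs (SecondCountableTopology {x : EuclideanSpace ℝ (Fin (n + 1)) // 0 ≤ x 0})
  haveI : Small.{0} W := small_of_compactSpace_chartedSpace (X := W) (EuclideanHalfSpace (n + 1))
  let φ : W ≃ₜ Shrink.{0} W := Shrink.homeomorph W
  haveI : T2Space (Shrink.{0} W) := φ.t2Space
  haveI : CompactSpace (Shrink.{0} W) := φ.compactSpace
  letI : ChartedSpace W (Shrink.{0} W) := φ.symm.toOpenPartialHomeomorph.singletonChartedSpace rfl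
  letI : ChartedSpace (EuclideanHalfSpace (n + 1)) (Shrink.{0} W) :=
    ChartedSpace.comp (EuclideanHalfSpace (n + 1)) W (Shrink.{0} W)
  -- the boundaries correspond (topological invariance of the boundary)
  have hbd : ∀ x : W, φ x ∈ (𝓡∂ (n + 1)).boundary (Shrink.{0} W) ↔ x ∈ (𝓡∂ (n + 1)).boundary W :=
    mem_boundary_iff_of_homeomorph φ
  have hbd₁ : MapsTo φ ((𝓡∂ (n + 1)).boundary W) ((𝓡∂ (n + 1)).boundary (Shrink.{0} W)) :=
    fun x hx => (hbd x).2 hx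
  have hbd₂ : MapsTo φ.symm ((𝓡∂ (n + 1)).boundary (Shrink.{0} W)) ((𝓡∂ (n + 1)).boundary W) := by
    intro y hy
    have hy' : φ (φ.symm y) ∈ (𝓡∂ (n + 1)).boundary (Shrink.{0} W) := by rwa [φ.apply_symm_apply]
    exact (hbd (φ.symm y)).1 hy'
  -- the transported fundamental class and pieces
  have hz' := IsRelFundamentalClass.xEquiv_of_homeomorph (R := ℤ) φ hbd₁ hbd₂ hz
  have hA' : IsClosed (φ '' A) := (hA.isCompact.image φ.continuous).isClosed
  have hB' : IsClosed (φ '' B) := (hB.isCompact.image φ.continuous).isClosed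
  have hdisj' : Disjoint (φ '' A) (φ '' B) := (Set.disjoint_image_iff φ.injective).2 hdisj
  have hAB' : φ '' A ∪ φ '' B = (𝓡∂ (n + 1)).boundary (Shrink.{0} W) := by
    rw [← Set.image_union, hAB]
    ext y
    constructor
    · rintro ⟨x, hx, rfl⟩
      exact hbd₁ hx
    · intro hy
      exact ⟨φ.symm y, hbd₂ hy, φ.apply_symm_apply y⟩
  have hyp' : ∀ j, j ≤ m → IsZero (relativeSingularHomology ℤ ℤ (Shrink.{0} W) (φ '' B) j) :=
    fun j hj => relativeSingularHomology.isZero_of_homeomorph ℤ ℤ φ (mapsTo_image φ B)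
      (fun y hy => by obtain ⟨x, hx, rfl⟩ := hy; rw [φ.symm_apply_apply]; exact hx) j (hyp j hj)
  -- the theorem in `Type`, transported back
  have h0 := isZero_relativeSingularHomology_of_boundary_split_typeZero (W := Shrink.{0} W)
    hA' hB' hdisj' hAB' _ hz' hyp' k hk
  refine relativeSingularHomology.isZero_of_homeomorph ℤ ℤ φ.symm (A := φ '' A) (B := A) ?_ ?_ k h0
  · intro y hy
    obtain ⟨x, hx, rfl⟩ := hy
    rw [φ.symm_apply_apply]
    exact hx
  · intro x hx
    exact ⟨x, hx, by rw [Homeomorph.symm_symm]⟩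

/-- **The duality step of Wall's proof of Thm. 2 — DISCHARGE of the named fact
`Cobordism.isZero_relativeSingularHomology_inl_of_inr_le`** (Wall 1964, p. 146,
"`Hₖ(R, M₁) ≅ H⁵⁻ᵏ(R, M₂) = 0`"; Hatcher 2002, Thm. 3.43 with Thm. 3.2): for a cobordism
`W : Cobordism n M N` between compact Hausdorff `n`-manifolds with a relative fundamental class
`z ∈ Hₙ₊₁(W, ∂W; ℤ)`, if `Hⱼ(W, N; ℤ) = 0` for all `j ≤ m` then `Hₖ(W, M; ℤ) = 0` for all `k` with
`n + 1 ≤ k + m` — `isZero_relativeSingularHomology_of_boundary_split` for the pieces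
`A = range inl`, `B = range inr` of `∂W` (compact, disjoint, covering the boundary).
[cite: HatcherAT2002, §3.3 Thm. 3.43 with Thm. 3.2 (proof, p. 254)] [cite: WallJLMS1964, §2, p. 146 ("and so also")] -/
theorem Cobordism.isZero_relativeSingularHomology_inl_of_inr_le_holds :
    Cobordism.isZero_relativeSingularHomology_inl_of_inr_le := by
  intro n m M N _ _ _ _ _ _ _ _ W z hz hN k hk
  exact isZero_relativeSingularHomology_of_boundary_split
    (isCompact_range W.continuous_inl).isClosed (isCompact_range W.continuous_inr).isClosed
    W.disjoint_range W.range_inl_union_range_inr z hz hN k hk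

/-! ### The last two sentences of Wall's proof, outright -/

section Outright

open Literature.AlgebraicTopology.Homotopy

variable {n : ℕ} {M N : Type u} [TopologicalSpace M] [T2Space M] [CompactSpace M]
  [ChartedSpace (EuclideanSpace ℝ (Fin n)) M] [TopologicalSpace N] [T2Space N] [CompactSpace N]
  [ChartedSpace (EuclideanSpace ℝ (Fin n)) N]

/-- **"… and so also `Hₖ(R, M₁) ≅ H⁵⁻ᵏ(R, M₂) = 0`, so that all the relative homology groups
vanish" — outright** (Wall 1964, p. 146): if `W : Cobordism n M N` has simply connected total
space and the relative groups `Hⱼ(W, M; ℤ)`, `Hⱼ(W, N; ℤ)` of BOTH ends vanish for `j ≤ m`, where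
`n ≤ 2m`, then all relative groups of both ends vanish — the conditional
`Cobordism.isZero_relativeSingularHomology_of_le` (`HCobordismWallDuality.lean`) fed with the
DISCHARGED duality step `Cobordism.isZero_relativeSingularHomology_inl_of_inr_le_holds`. PROVED, no
hypothesis beyond the cobordism. [cite: WallJLMS1964, §2, p. 146 ("and so also")] [cite: HatcherAT2002, Prop. 3.25, Thm. 3.43 with Thm. 3.2] -/
theorem Cobordism.forall_isZero_relativeSingularHomology_of_le {m : ℕ} (hnm : n ≤ 2 * m)
    (W : Cobordism n M N) [SimplyConnectedSpace W.W]
    (hM : ∀ j : ℕ, j ≤ m → IsZero (relativeSingularHomology ℤ ℤ W.W (range W.inl) j))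
    (hN : ∀ j : ℕ, j ≤ m → IsZero (relativeSingularHomology ℤ ℤ W.W (range W.inr) j)) :
    (∀ k : ℕ, IsZero (relativeSingularHomology ℤ ℤ W.W (range W.inl) k)) ∧
      ∀ k : ℕ, IsZero (relativeSingularHomology ℤ ℤ W.W (range W.inr) k) :=
  W.isZero_relativeSingularHomology_of_le Cobordism.isZero_relativeSingularHomology_inl_of_inr_le_holds
    hnm hM hN

/-- **The last two sentences of Wall's proof of Thm. 2, for any cobordism, outright** (1964,
p. 146: "Hence `Hₖ(R, Mᵢ) = 0` for `k ≤ 2` … and so also … so that all the relative homology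
groups vanish, and `R` is indeed an h-cobordism"): a cobordism `W : Cobordism n M N` between simply
connected compact Hausdorff `n`-manifolds whose total space is simply connected and whose relative
groups of both ends vanish in degrees `≤ m`, `n ≤ 2m`, is an h-cobordism — the conditional
`Cobordism.isHCobordism_of_isZero_relativeSingularHomology_le` (`HCobordismWallDuality.lean`) fed
with the discharged duality step (`Cobordism.isZero_relativeSingularHomology_inl_of_inr_le_holds`,
this file), Whitehead's theorem (`whitehead_exists_homotopyEquiv_holds`, Hatcher Cor. 4.33) and the
CW type of compact manifolds without and with boundary
(`exists_cwComplex_homotopyEquiv_of_compactSpace_holds`,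
`exists_cwComplex_homotopyEquiv_of_compactSpace_boundary_holds`, Hatcher Cor. A.12). PROVED, no
hypothesis beyond the cobordism. [cite: WallJLMS1964, §2, p. 146] [cite: HatcherAT2002, Thm. 3.43, Cor. 4.33, Cor. A.12] -/
theorem Cobordism.isHCobordism_of_isZero_relativeSingularHomology_le'
    [SimplyConnectedSpace M] [SimplyConnectedSpace N] {m : ℕ} (hnm : n ≤ 2 * m)
    (W : Cobordism n M N) [SimplyConnectedSpace W.W]
    (hM : ∀ j : ℕ, j ≤ m → IsZero (relativeSingularHomology ℤ ℤ W.W (range W.inl) j))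
    (hN : ∀ j : ℕ, j ≤ m → IsZero (relativeSingularHomology ℤ ℤ W.W (range W.inr) j)) :
    W.IsHCobordism :=
  W.isHCobordism_of_isZero_relativeSingularHomology_le
    Cobordism.isZero_relativeSingularHomology_inl_of_inr_le_holds whitehead_exists_homotopyEquiv_holds
    exists_cwComplex_homotopyEquiv_of_compactSpace_holds
    exists_cwComplex_homotopyEquiv_of_compactSpace_boundary_holds hnm hM hN

end Outright

/-- **Wall's case `n = 4`, `m = 2`, outright** (1964, p. 146): **a cobordism `R` between simply
connected compact Hausdorff 4-manifolds `M`, `N` with `R` simply connected and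
`Hₖ(R, M; ℤ) = Hₖ(R, N; ℤ) = 0` for `k ≤ 2` is an h-cobordism** — no hypothesis left
(`Cobordism.isHCobordism_of_isZero_relativeSingularHomology_le'` with `4 ≤ 2 · 2`). So a
construction of Wall's `R` (§2, pp. 144–146: `M # (−N)`, Thm. 1, Lemma 2, [10], [11], the algebraic
lemma, re-gluing `V` and filling the neck) together with his computation "`H₂(Mᵢ) → H₂(R)` are
isomorphisms … Hence `Hₖ(R, Mᵢ) = 0` for `k ≤ 2`" yields Thm. 2 for `M`, `N` by this theorem.
PROVED. [cite: WallJLMS1964, §2, p. 146] -/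
theorem Cobordism.isHCobordism_of_isZero_relativeSingularHomology_le_two'
    {M N : Type u} [TopologicalSpace M] [T2Space M] [CompactSpace M]
    [ChartedSpace (EuclideanSpace ℝ (Fin 4)) M] [SimplyConnectedSpace M] [TopologicalSpace N]
    [T2Space N] [CompactSpace N] [ChartedSpace (EuclideanSpace ℝ (Fin 4)) N] [SimplyConnectedSpace N]
    (R : Cobordism 4 M N) [SimplyConnectedSpace R.W]
    (hle : ∀ k : ℕ, k ≤ 2 →
      IsZero (relativeSingularHomology ℤ ℤ R.W (range R.inl) k) ∧
        IsZero (relativeSingularHomology ℤ ℤ R.W (range R.inr) k)) :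
    R.IsHCobordism :=
  R.isHCobordism_of_isZero_relativeSingularHomology_le' (m := 2) (by norm_num)
    (fun j hj => (hle j hj).1) (fun j hj => (hle j hj).2)

/-- **Wall's Thm. 2 for one pair, from a constructed `R` known in degrees `≤ 2`, outright**
(1964, §2, pp. 145–146): simply connected compact Hausdorff 4-manifolds `M`, `N` joined by a
cobordism `R` with `R` simply connected and `Hₖ(R, M; ℤ) = Hₖ(R, N; ℤ) = 0` for `k ≤ 2` are
h-cobordant (`IsHCobordant 4 M N`) — the form in which a future construction of `R` closes the
frozen leaf `isHCobordant_of_equivalent_intersectionForm` (`HCobordismDonaldson.lean`) for the pair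
at hand. PROVED. [cite: WallJLMS1964, Thm. 2 with §2, pp. 145–146] -/
theorem isHCobordant_of_isZero_relativeSingularHomology_le_two
    {M N : Type u} [TopologicalSpace M] [T2Space M] [CompactSpace M]
    [ChartedSpace (EuclideanSpace ℝ (Fin 4)) M] [SimplyConnectedSpace M] [TopologicalSpace N]
    [T2Space N] [CompactSpace N] [ChartedSpace (EuclideanSpace ℝ (Fin 4)) N] [SimplyConnectedSpace N]
    (R : Cobordism 4 M N) [SimplyConnectedSpace R.W]
    (hle : ∀ k : ℕ, k ≤ 2 →
      IsZero (relativeSingularHomology ℤ ℤ R.W (range R.inl) k) ∧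
        IsZero (relativeSingularHomology ℤ ℤ R.W (range R.inr) k)) :
    IsHCobordant 4 M N :=
  ⟨R, R.isHCobordism_of_isZero_relativeSingularHomology_le_two' hle⟩

end Literature.Topology.FourManifolds

end
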